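import Summits.QuantumFields.BalabanUV.T4Continuum.Support.ShellMeasureLandauEndFinalToyMass

/-!
# `T4Continuum.ShellMeasureLandauEndFinalToyRho` — row S88 f3: the END-II-final of record applied to the S88 model with the
# relative scale `ρ` SYMBOLIC, and the LIVE instance at `D·ρ < 1`
(cell `pub-balaban`, sub-cell `t4`, spine estimate NE7c (node U5b); NE7c ROUND-2 crew, unit
`b2b-balaban-t4-ne7c-formalise-leaf-04` gen 8 — file 3 of row S88 of `t4/b2b-balaban-t4-ne7c-p1/LEAVES-NE7c-P1.md`; ADDITIVE —
imports file 2 `ShellMeasureLandauEndFinalToyMass` ONLY (hence S88 f1 `ShellMeasureLandauEndFinalToy` p229790 and S76 f2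
`ShellMeasureLandauEndFinal` p227065); [folklore]; 0 `def`, 0 `def … : Prop`, 0 sorry, 0 citation)

HONEST FRAMING.  A CONSISTENCY CERTIFICATE of the END-II-final of record's binder family on the one-plaquette `SU(2)` model of
S88, with ONE datum generalised: the relative scale `ρ`.  Nothing of Bałaban's (minimiser, propagators, densities); finite
four-torus programme, rung (B)+1 only — NOT infinite volume, NOT a mass gap, NOT the Clay problem, NOT summit progress; NE7c
(`T4IndicatorShell.ShellWeightBound`) NOT PRINTED, NOT PROVED; «NE7c ⇐ the named binders» (c3); (M1) realized on a toy ≠ NE7c.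

WHY.  File 2 §0 (`slotAntiConcentration_of_one_le_mul`, `toy_D_mul_quarter`): at S88's numbers `ρ = ¼`, `D = 4m₀ = 12`, the
(M1) INEQUALITY the END concludes is implied by monotonicity (`D·ρ = 3 ≥ 1`).  The END's own constraint on the scale is only
`0 ≤ ρ ≤ (1−δ)∕2 = ¼` and its constant `D = 2(m₀ + B_W + B_E)∕(1−δ)` does not depend on `ρ`; so §1 re-applies S76 f2
`slotAC_realized_su2_landauChart_final` BY NAME to the S88 data with `ρ ∈ [0, ¼]` a PARAMETER (`slotAC_final_toy_rho`; the
`ρ = ¼` case is S88's `slotAC_final_toy`; the proof is S88's `refine` with the two `ρ`-slots generalised — every other binder met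
by the SAME explicit data of S88), and §2 records the LIVE instance (`slotAC_final_toy_live`): for `0 < S ≤ 10⁻⁵`, `0 < ρ ≤ ¼`,
(M1) from the END ∧ POSITIVE realized shell mass (file 2 `toy_shellMass_pos`: the one-link class mass `haar{θ(1−ρ) ≤ dist1 < θ}`)
∧ total mass in `(0, 1]`; at `ρ = 1∕20`, `D·ρ = 3∕5 < 1` (file 2 `toy_D_mul_rho`) — there the inequality is NOT implied by
monotonicity and the shell is live: the END-II-final of record is non-vacuous in BOTH senses at explicit data.
NOTHING in the countdown moves; NE7c NOT PROVED; spine PROVED 0∕9.  HONEST DEPENDENCY (cell): continuum YM on T⁴ ⇐ BetaPertH ∧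
nine spine estimates (0/9 proved); BetaPertH ⇐ (D1) ∧ (D4) ∧ CAP+tail; G-an2-4 gates asym, D1 and NE2/3/4.
-/

noncomputable section

open Set Metric NormedSpace MeasureTheory Function

namespace Summit.QuantumFields.BalabanUV.T4Continuum.ShellMeasureLandauEndFinalToyRho

open scoped ENNReal Matrix.Norms.L2Operator
open Literature.MathematicalPhysics.QuantumLattice (quatMatrix)
open Literature.MathematicalPhysics.QuantumFieldTheory.Balaban1983to89
open B11Prop6Scheme (Prop4Hyp mapT)
open GaugeField (GaugeInvariant plaqHol gaugeAct)
open T4ShellMeasure (SlotAntiConcentration)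
open T4CubePoincare (cube mem_cube_iff)
open T4CubeChartGnomonic (SU2)
open T4CubeChartExp (toE expPt expChart expFibreChart block_mem_cube toE_mem_ball_of_mem_cube)
open T4TreeGaugeFixing (NoClosedLoop fixTo noClosedLoop_empty fixTo_empty)
open T4ExpWindowSmallField (dist1_expPt_eq dist1_eq_norm_coe_sub_one)
open ShellMeasureLevelAssembly (classifier)
open ShellMeasureWilsonWords (wordExp wordExp_cons wordExp_nil)
open ShellMeasureLandauHolonomy (solAt landauExp solAt_eq_of_unique)
open ShellMeasureLandauHolonomyChart (holOf cplx holOf_apply)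
open ShellMeasureLandauHolonomySkew (readOutReal)
open ShellMeasureWilsonRealizedSU2 (M₂ gen coe_chart gen_mem_skewAdjoint)
open ShellMeasureLandauEndFinal (slotAC_realized_su2_landauChart_final)
open ShellMeasureLandauEndFinalToy (b₁ staple toyCentre toyF toyU tau toyReadOut toyJco toyεθ plaqHol_update
  dist1_plaqHol_section measurable_toyU measurable_toyF gaugeInvariant_toyU gaugeInvariant_toyF toyF_le_one toyF_supp
  norm_toyReadOut_le toyReadOut_cplx solAt_zero landauExp_zero smul_mem_cube toyF_section_mono toyεθ_pos slotAC_final_toy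
  toy_threshold_lt_window)
open ShellMeasureLandauEndFinalToyMass (toy_shellMass_pos toy_totalMass_pos_le_one toy_D_mul_rho)

/-! ## §1 The END-II-final of record applied to the S88 model with `ρ` SYMBOLIC -/

section Rho

variable {P : Params} {j : ℕ} [DecidableEq (PBond P j)]

/-- **S88 WITH `ρ ∈ [0, ¼]` SYMBOLIC.**  S76 f2 `ShellMeasureLandauEndFinal.slotAC_realized_su2_landauChart_final` APPLIED BY
NAME to the one-plaquette model of S88 (`ShellMeasureLandauEndFinalToy`: every binder met by the same explicit data — block
`Λ = {b₁ p}`, `T = ∅`, covariant centre `(staple V p)⁻¹`, density `toyF`, classifier `toyU`, trivial scheme tuple, one read-out,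
`δ = ½`, `β = 0`, `η = z = c₁ = c₂ = 1`, `εθ = 144∕(r_Φ∕S − 1)²`) except that the relative scale `ρ` is a PARAMETER subject to the
END's own constraint `0 ≤ ρ ≤ (1−δ)∕2 = ¼`; S88's `slotAC_final_toy` is the case `ρ = ¼`.  A consistency certificate; nothing
about Bałaban's objects; NE7c NOT PROVED. [folklore] -/
theorem slotAC_final_toy_rho (p : Plaq P j) {m₀ : ℕ} (e : ↥({b₁ p} : Finset (PBond P j)) × Fin 3 ≃ Fin m₀)
    {S : ℝ} (hS : 0 < S) (hS6 : S < 1 / 6) {ρ : ℝ} (hρ0 : 0 ≤ ρ) (hρ4 : ρ ≤ 1 / 4) :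
    SlotAntiConcentration ((fieldMeasure P j SU2).withDensity (toyF S p)) (toyU p) (toyεθ S * 1 ^ 2) ρ
      (2 * ((m₀ : ℝ) + (0 + 0)) / (1 - 1 / 2)) := by
  have hSπ : 3 * S ^ 2 < Real.pi ^ 2 := by nlinarith [Real.pi_gt_three]
  have hRad : (1 / 6 : ℝ) / S - 1 ≠ 0 := by
    have h : 1 < (1 / 6) / S := by rw [lt_div_iff₀ hS]; linarith
    linarith
  refine slotAC_realized_su2_landauChart_final (P := P) (j := j) (n := Fin 2)
    (𝒴 := Fin m₀ → ℂ) (𝒴' := Fin m₀ → ℂ) (𝒳 := Fin m₀ → ℂ) (𝒵 := Fin m₀ → ℂ) (ℬ := Fin m₀ → ℂ)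
    (T := ∅) noClosedLoop_empty 1 {b₁ p} e hS hSπ (toyCentre p) (measurable_toyF S p) (gaugeInvariant_toyF S p)
    (toyF_supp S p 1) (measurable_toyU p) (gaugeInvariant_toyU p) (ι := Unit) (Pu := {()})
    (Finset.singleton_nonempty ()) (fun _ => cube m₀ S) (toyJco S p e) (δ := 1 / 2) (ρ := ρ) (β := 0)
    (fun _ => 0) (fun _ _ => 0) (B₀ := 1) (C₄ := 0) (a₃ := 2 / 3) (ε₄ := 1 / 6)
    (fun _ f => by simp) (fun _ => ⟨fun Y _ => by simp, differentiableOn_const _⟩) one_pos le_rfl (by norm_num)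
    (dL := 1) (C₁ := 1) (B₃ := 1) (ε₁ := 1 / 12) zero_le_one zero_le_one (by norm_num) le_rfl (by norm_num)
    (by norm_num) (by norm_num)
    (fun _ => ContinuousLinearMap.id ℂ (Fin m₀ → ℂ)) (fun _ B => by simp) (fun _ => id) (rΦ := 1 / 6)
    (fun _ => differentiableOn_id) (fun _ => rfl)
    (fun _ z hz => by rw [mem_ball_zero_iff] at hz; simp only [id]; linarith) (by linarith)
    (fun _ _ => 0) (C₂ := 0) (RC := 1) le_rfl (fun _ Z _ => by simp) (fun _ => differentiableOn_const _)
    (fun _ => 0) (fun _ Y => by simp) (fun _ => 0) (fun _ X => by simp) (ε₃ := 1 / 3) (by norm_num) (by norm_num)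
    (by norm_num) (fun _ => [toyReadOut p e]) (κr := 3) (by norm_num)
    (fun _ _ ℓ hℓ Y => by rw [List.mem_singleton.1 hℓ]; exact norm_toyReadOut_le p e Y) (m := 1)
    (fun _ _ => by simp) (κc := 3) (by norm_num)
    (fun _ _ Y => by simpa using norm_toyReadOut_le p e Y)
    (fun _ _ => 0) (fun _ _ => 0) (BW := 0) (BE := 0) (BElb := 0)
    (fun _ x _ c' _ _ => by simp) le_rfl (fun _ x _ c' _ _ => by simp) le_rfl (fun _ y _ => le_rfl)
    (fun _ y _ => by simp) {toyReadOut p e} ⊤ ⊤ ⊤ (by simp) (readOutReal {toyReadOut p e})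
    (fun _ f _ => by simp) (fun _ Y _ => AddSubgroup.mem_top _)
    (fun _ Y _ => AddSubgroup.mem_top _) (fun _ X _ => by simp)
    (fun _ Z _ => AddSubgroup.mem_top _) (fun _ B hB => by simpa using hB)
    (fun _ y _ => ?_) (fun V x hx => ?_) (fun V x _ => ?_)
    (fun V x hJ => ?_) (fun V x a ha => ?_) (fun V x => ?_) (fun _ => ShellMeasureLandauHolonomyPrint.chartCube_subset_closedBall hS.le)
    (by norm_num) (by norm_num) hρ0 (by linarith) le_rfl (η := 1) (εθ := toyεθ S) (c₁ := 1) (c₂ := 1)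
    (z := 1) one_pos (toyεθ_pos hS hS6) (by norm_num) (by norm_num) (by norm_num) ?_
  · -- `hΦr`: the identity coarse field is real at real points — the read-out of `cplx y` is skew-Hermitian
    intro ℓ hℓ
    rw [Set.mem_singleton_iff.1 hℓ]
    show toyReadOut p e (cplx y) ∈ skewAdjoint M₂
    rw [toyReadOut_cplx]; exact gen_mem_skewAdjoint _ _ _ _
  · -- `hRdict`: `F(section x) = Jco V x · e^{−0}` on the cube
    rw [fixTo_empty, toyJco, indicator_of_mem hx]
    simp
  · -- `hudict`: THE DICTIONARY — `u ∘ section = ‖exp (gen x) − 1‖ = classifier` of the one-letter word `[ℓ (Z x)]`,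
    -- `Z x = cplx x` (trivial chain), `ℓ (cplx x) = gen x` (§3), `exp (gen x)` = the chart bond (level-0 `coe_chart`)
    have h1 : expFibreChart {b₁ p} (1 : GaugeField P j SU2) e x ⟨b₁ p, Finset.mem_singleton_self _⟩ =
        expPt (fun i => x (e (⟨b₁ p, Finset.mem_singleton_self _⟩, i))) :=
      show (1 : SU2) * _ = _ from one_mul _
    rw [fixTo_empty, toyU, dist1_plaqHol_section, dist1_eq_norm_coe_sub_one, ← h1, coe_chart]
    simp only [classifier, Finset.sup'_singleton, holOf_apply, List.map_cons, List.map_nil, wordExp_cons, wordExp_nil,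
      mul_one, landauExp_zero, solAt_zero _ (by norm_num : (0 : ℝ) ≤ 1 / 6), zero_add, ContinuousLinearMap.coe_id',
      id, toyReadOut_cplx]
  · -- `hJW`: `Jco` lives on the cube
    by_contra h
    exact hJ (indicator_of_notMem h _)
  · -- `hJ`: centre-monotone
    unfold toyJco
    by_cases hx : x ∈ cube m₀ S
    · rw [indicator_of_mem hx, indicator_of_mem (smul_mem_cube hx ha)]
      exact toyF_section_mono hSπ p e V hx ha
    · rw [indicator_of_notMem hx]; exact bot_le
  · -- `hJ1`
    unfold toyJco
    by_cases hx : x ∈ cube m₀ S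
    · rw [indicator_of_mem hx]; exact toyF_le_one S p _
    · rw [indicator_of_notMem hx]; exact bot_le
  · -- `hsm`: (SM) with equality at `εθ = 144∕(r_Φ∕S − 1)²`
    unfold toyεθ
    rw [show (36 : ℝ) * (1 * 1 + ((1 : ℕ) : ℝ) ^ 2 * 1 ^ 2 * 1 ^ 2) = 72 by norm_num,
      show (1 / 2 : ℝ) * (144 / ((1 / 6) / S - 1) ^ 2) = 72 / ((1 / 6) / S - 1) ^ 2 by ring]

end Rho

/-! ## §2 Headline: the END-II-final toy is LIVE in every sense -/

section Live

variable {P : Params} {j : ℕ} [DecidableEq (PBond P j)]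

/-- **ROW S88, MEASURE HALF: THE END-II-final OF RECORD IS NON-VACUOUS IN BOTH SENSES AT THE TOY DATA.**  For every torus of the
cell, level, plaquette `p`, chart enumeration `e`, window `0 < S ≤ 10⁻⁵` and relative scale `0 < ρ ≤ ¼`: (i) the END S76 f2 FIRES
(§1, every binder met by explicit data) and gives (M1) `SlotAntiConcentration μ_F u (εθ·1²) ρ (2(m₀ + 0 + 0)∕(1 − ½))`; (ii) the
shell `{θ(1−ρ) ≤ u < θ}` has POSITIVE realized mass (file 2: the one-link class mass `haar{θ(1−ρ) ≤ dist1 < θ}`); (iii) the total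
mass is in `(0, 1]`.  With `ρ = 1∕20`, `D·ρ = 3∕5 < 1` (file 2 `toy_D_mul_rho`): the inequality is not implied by monotonicity (file 2 §0).
A sanity check of OUR composition; nothing of Bałaban's; NE7c NOT PROVED; NOTHING in the countdown moves. [folklore] -/
theorem slotAC_final_toy_live (p : Plaq P j) {m₀ : ℕ} (e : ↥({b₁ p} : Finset (PBond P j)) × Fin 3 ≃ Fin m₀)
    {S : ℝ} (hS : 0 < S) (hS5 : S ≤ 1 / 100000) {ρ : ℝ} (hρ : 0 < ρ) (hρ4 : ρ ≤ 1 / 4) :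
    SlotAntiConcentration ((fieldMeasure P j SU2).withDensity (toyF S p)) (toyU p) (toyεθ S * 1 ^ 2) ρ
        (2 * ((m₀ : ℝ) + (0 + 0)) / (1 - 1 / 2)) ∧
      0 < ((fieldMeasure P j SU2).withDensity (toyF S p))
        {U | toyεθ S * 1 ^ 2 * (1 - ρ) ≤ toyU p U ∧ toyU p U < toyεθ S * 1 ^ 2} ∧
      0 < ((fieldMeasure P j SU2).withDensity (toyF S p)) univ ∧
      ((fieldMeasure P j SU2).withDensity (toyF S p)) univ ≤ 1 := by
  have hS6 : S < 1 / 6 := by linarith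
  exact ⟨slotAC_final_toy_rho p e hS hS6 hρ.le hρ4, toy_shellMass_pos hS hS5 p hρ (by linarith),
    toy_totalMass_pos_le_one hS hS6 p⟩

/-- the `ρ = 1∕20` instance spelled out: `D·ρ < 1` AND (M1) AND a live shell. [folklore] -/
theorem slotAC_final_toy_live_twentieth (p : Plaq P j) {m₀ : ℕ} (e : ↥({b₁ p} : Finset (PBond P j)) × Fin 3 ≃ Fin m₀)
    {S : ℝ} (hS : 0 < S) (hS5 : S ≤ 1 / 100000) :
    2 * ((m₀ : ℝ) + (0 + 0)) / (1 - 1 / 2) * (1 / 20) < 1 ∧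
      SlotAntiConcentration ((fieldMeasure P j SU2).withDensity (toyF S p)) (toyU p) (toyεθ S * 1 ^ 2) (1 / 20)
        (2 * ((m₀ : ℝ) + (0 + 0)) / (1 - 1 / 2)) ∧
      0 < ((fieldMeasure P j SU2).withDensity (toyF S p))
        {U | toyεθ S * 1 ^ 2 * (1 - 1 / 20) ≤ toyU p U ∧ toyU p U < toyεθ S * 1 ^ 2} := by
  obtain ⟨h1, h2, -⟩ := slotAC_final_toy_live p e hS hS5 (by norm_num : (0 : ℝ) < 1 / 20) (by norm_num)
  exact ⟨toy_D_mul_rho p e, h1, h2⟩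

end Live

end Summit.QuantumFields.BalabanUV.T4Continuum.ShellMeasureLandauEndFinalToyRho

end
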